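import Summits.ResolutionOfSingularities.ResolutionOfSingularities.Theses.UniversalCells
import HarnessLib

/-!
# `MatroidCellRes`, line `birth` — a chart presentation of the six-column example has dimension ≥ 2
# (algebra for `SaturatedChartIntegralityLoadBearing`)

Support (negative) lemma material for crux stmt-ResolutionOfSingularities-15230
(`Summit.ResolutionOfSingularities.ResolutionOfSingularities.Theses.UniversalCells.MatroidCellRes`,
route UniversalCells, rank 2), filed by the crux disprover (cdisprove seat, generation 2); companion
of `Negative/ChartPresentation.lean` (see there for the notion of a chart presentation
`ι : 𝔽_p[A] → T` of generation 1's six-column Γ-scheme: `ι` kills `det A`, `a₀₀a₁₂ - a₀₂a₁₀`,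
`a₀₂`, `a₁₀`, `a₂₁`, makes `g₀ = a₀₁a₂₀a₁₁a₂₂` a unit, and is universal — only the universality
`hlift` is used here). This file declares no definition and no notation.

## Content

`two_le_ringKrullDim_of_lift`: `dim T ≥ 2`, by the chain of three primes
`ker(T → 𝔽_p[s,t][1/(st)]) < ker(T → 𝔽_p[s,t][1/t]) < ker(T → 𝔽_p)` obtained from the points
`a₀₁ ↦ s`, `a₂₀ ↦ t`, `a₁₁ = a₂₂ = 1`, other entries `0` (then `s ↦ 1`, then `t ↦ 1`), which kill the
five relations and make `g₀ ↦ st, t, 1` units; `a₀₁ - 1` and `a₂₀ - 1` separate consecutive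
kernels (`𝔽_p[s,t] → 𝔽_p[s,t][1/(st)]` is injective). It discharges the dimension hypothesis
`hdim : ¬ dim ≤ 1` of the residue stub (N) for the disprover's witness. Folklore.
-/

noncomputable section

-- single-problem summit: the doubled namespace component `ResolutionOfSingularities` is forced
set_option linter.dupNamespace false

open MvPolynomial (X C)

namespace Summit.ResolutionOfSingularities.ResolutionOfSingularities.Theorems.MatroidCellRes.Negative

section Chart

variable {p : ℕ} [Fact p.Prime] {T : Type} [CommRing T]
  (ι : MvPolynomial (Fin 3 × Fin 3) (ZMod p) →+* T)

/-- **A chart presentation has Krull dimension `≥ 2`.** The maps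
`𝔽_p[A] → D₀ = 𝔽_p[s,t][1/(st)]` (`a₀₁ ↦ s`, `a₂₀ ↦ t`, `a₁₁, a₂₂ ↦ 1`, other entries `↦ 0`),
`D₀ → D₁ = 𝔽_p[s,t][1/t]` (`s ↦ 1`) and `D₁ → 𝔽_p` (`t ↦ 1`) kill the five relations and make
`g₀ ↦ st, t, 1` units; their kernels in `T` (`hlift`) are primes `𝔭₀ < 𝔭₁ < 𝔭₂` (`a₀₁ - 1`
separates the first two, `a₂₀ - 1` the last two). [folklore] -/
theorem two_le_ringKrullDim_of_lift
    (hlift : ∀ (D : Type) [CommRing D] (ψ : MvPolynomial (Fin 3 × Fin 3) (ZMod p) →+* D),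
      ψ (X (0,0) * X (1,1) * X (2,2) - X (0,0) * X (1,2) * X (2,1)
        - X (0,1) * X (1,0) * X (2,2) + X (0,1) * X (1,2) * X (2,0)
        + X (0,2) * X (1,0) * X (2,1) - X (0,2) * X (1,1) * X (2,0)) = 0 →
      ψ (X (0,0) * X (1,2) - X (0,2) * X (1,0)) = 0 →
      ψ (X (0,2)) = 0 → ψ (X (1,0)) = 0 → ψ (X (2,1)) = 0 →
      IsUnit (ψ (X (0,1) * X (2,0) * X (1,1) * X (2,2))) →
      ∃ φ : T →+* D, ∀ a, φ (ι a) = ψ a) :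
    ((2 : ℕ) : WithBot ℕ∞) ≤ ringKrullDim T := by
  classical
  -- the three test domains `D₀ = 𝔽_p[s,t][1/(st)]`, `D₁ = 𝔽_p[s,t][1/t]`, `𝔽_p`
  have hst : (X 0 * X 1 : MvPolynomial (Fin 2) (ZMod p)) ≠ 0 :=
    mul_ne_zero (MvPolynomial.X_ne_zero _) (MvPolynomial.X_ne_zero _)
  have ht : (X 1 : MvPolynomial (Fin 2) (ZMod p)) ≠ 0 := MvPolynomial.X_ne_zero _
  haveI : IsDomain (Localization.Away (X 0 * X 1 : MvPolynomial (Fin 2) (ZMod p))) :=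
    IsLocalization.isDomain_localization (powers_le_nonZeroDivisors_of_noZeroDivisors hst)
  haveI : IsDomain (Localization.Away (X 1 : MvPolynomial (Fin 2) (ZMod p))) :=
    IsLocalization.isDomain_localization (powers_le_nonZeroDivisors_of_noZeroDivisors ht)
  have hinj₀ : Function.Injective (algebraMap (MvPolynomial (Fin 2) (ZMod p))
      (Localization.Away (X 0 * X 1 : MvPolynomial (Fin 2) (ZMod p)))) :=
    IsLocalization.injective _ (powers_le_nonZeroDivisors_of_noZeroDivisors hst)
  have hinj₁ : Function.Injective (algebraMap (MvPolynomial (Fin 2) (ZMod p))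
      (Localization.Away (X 1 : MvPolynomial (Fin 2) (ZMod p)))) :=
    IsLocalization.injective _ (powers_le_nonZeroDivisors_of_noZeroDivisors ht)
  have hX0 : (X 0 - 1 : MvPolynomial (Fin 2) (ZMod p)) ≠ 0 := by
    intro h
    have h' := congrArg (MvPolynomial.eval fun _ => (0 : ZMod p)) h
    rw [map_sub, map_one, MvPolynomial.eval_X, map_zero] at h'
    exact zero_ne_one (sub_eq_zero.mp h')
  have hX1 : (X 1 - 1 : MvPolynomial (Fin 2) (ZMod p)) ≠ 0 := by
    intro h
    have h' := congrArg (MvPolynomial.eval fun _ => (0 : ZMod p)) h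
    rw [map_sub, map_one, MvPolynomial.eval_X, map_zero] at h'
    exact zero_ne_one (sub_eq_zero.mp h')
  -- `ψ₀ : 𝔽_p[A] → D₀`
  let val₀ : Fin 3 × Fin 3 → Localization.Away (X 0 * X 1 : MvPolynomial (Fin 2) (ZMod p)) :=
    fun ij =>
      if ij = (0,1) then algebraMap (MvPolynomial (Fin 2) (ZMod p)) _ (X 0)
      else if ij = (2,0) then algebraMap (MvPolynomial (Fin 2) (ZMod p)) _ (X 1)
      else if ij = (1,1) ∨ ij = (2,2) then 1 else 0
  have hv01 : val₀ (0,1) = algebraMap (MvPolynomial (Fin 2) (ZMod p)) _ (X 0) := by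
    simp [val₀]
  have hv20 : val₀ (2,0) = algebraMap (MvPolynomial (Fin 2) (ZMod p)) _ (X 1) := by
    simp [val₀]
  let ψ₀ : MvPolynomial (Fin 3 × Fin 3) (ZMod p) →+*
      Localization.Away (X 0 * X 1 : MvPolynomial (Fin 2) (ZMod p)) :=
    MvPolynomial.eval₂Hom (algebraMap (ZMod p) _) val₀
  have hψ₀X : ∀ ij, ψ₀ (X ij) = val₀ ij := fun ij => MvPolynomial.eval₂Hom_X' _ val₀ ij
  have hg₀ : ψ₀ (X (0,1) * X (2,0) * X (1,1) * X (2,2)) =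
      algebraMap (MvPolynomial (Fin 2) (ZMod p)) _ (X 0 * X 1) := by
    simp only [map_mul, hψ₀X]
    simp [val₀]
  obtain ⟨φ₀, hφ₀⟩ := hlift _ ψ₀
    (by simp only [map_sub, map_add, map_mul, hψ₀X]; simp [val₀])
    (by simp only [map_sub, map_mul, hψ₀X]; simp [val₀])
    (by rw [hψ₀X]; simp [val₀]) (by rw [hψ₀X]; simp [val₀]) (by rw [hψ₀X]; simp [val₀])
    (by rw [hg₀]; exact IsLocalization.Away.algebraMap_isUnit _)
  -- `ρ₁ : D₀ → D₁` (`s ↦ 1`) and `ρ₂ : D₁ → 𝔽_p` (`t ↦ 1`)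
  let e₁ : MvPolynomial (Fin 2) (ZMod p) →+* MvPolynomial (Fin 2) (ZMod p) :=
    MvPolynomial.eval₂Hom MvPolynomial.C (fun i => if i = 0 then 1 else X 1)
  have he₁0 : e₁ (X 0) = 1 := by
    simp only [e₁, MvPolynomial.eval₂Hom_X']
    simp
  have he₁1 : e₁ (X 1) = X 1 := by
    simp only [e₁, MvPolynomial.eval₂Hom_X']
    simp
  have hu₁ : IsUnit (((algebraMap (MvPolynomial (Fin 2) (ZMod p))
      (Localization.Away (X 1 : MvPolynomial (Fin 2) (ZMod p)))).comp e₁) (X 0 * X 1)) := by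
    rw [RingHom.comp_apply, map_mul, he₁0, he₁1, one_mul]
    exact IsLocalization.Away.algebraMap_isUnit _
  let ρ₁ : Localization.Away (X 0 * X 1 : MvPolynomial (Fin 2) (ZMod p)) →+*
      Localization.Away (X 1 : MvPolynomial (Fin 2) (ZMod p)) :=
    IsLocalization.Away.lift (X 0 * X 1 : MvPolynomial (Fin 2) (ZMod p)) hu₁
  have hρ₁ : ∀ r : MvPolynomial (Fin 2) (ZMod p),
      ρ₁ (algebraMap _ _ r) = algebraMap (MvPolynomial (Fin 2) (ZMod p)) _ (e₁ r) := fun r =>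
    IsLocalization.Away.lift_eq _ hu₁ r
  let e₂ : MvPolynomial (Fin 2) (ZMod p) →+* ZMod p := MvPolynomial.eval fun _ => 1
  have he₂1 : e₂ (X 1) = 1 := by
    simp only [e₂, MvPolynomial.eval_X]
  have hu₂ : IsUnit (e₂ (X 1)) := by rw [he₂1]; exact isUnit_one
  let ρ₂ : Localization.Away (X 1 : MvPolynomial (Fin 2) (ZMod p)) →+* ZMod p :=
    IsLocalization.Away.lift (X 1 : MvPolynomial (Fin 2) (ZMod p)) hu₂
  have hρ₂ : ∀ r : MvPolynomial (Fin 2) (ZMod p), ρ₂ (algebraMap _ _ r) = e₂ r := fun r =>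
    IsLocalization.Away.lift_eq _ hu₂ r
  -- the three primes
  let φ₁ : T →+* Localization.Away (X 1 : MvPolynomial (Fin 2) (ZMod p)) := ρ₁.comp φ₀
  let φ₂ : T →+* ZMod p := ρ₂.comp φ₁
  let q₀ : PrimeSpectrum T := ⟨RingHom.ker φ₀, RingHom.ker_isPrime φ₀⟩
  let q₁ : PrimeSpectrum T := ⟨RingHom.ker φ₁, RingHom.ker_isPrime φ₁⟩
  let q₂ : PrimeSpectrum T := ⟨RingHom.ker φ₂, RingHom.ker_isPrime φ₂⟩
  have h01 : q₀ < q₁ := by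
    refine lt_of_le_of_ne ?_ ?_
    · intro t (ht : φ₀ t = 0)
      show ρ₁ (φ₀ t) = 0
      rw [ht, map_zero]
    · intro h
      have hmem : ι (X (0,1)) - 1 ∈ q₁.asIdeal := by
        show ρ₁ (φ₀ (ι (X (0,1)) - 1)) = 0
        rw [map_sub, map_one, hφ₀, hψ₀X, hv01, map_sub, map_one, hρ₁, he₁0, map_one, sub_self]
      have hnot : ι (X (0,1)) - 1 ∉ q₀.asIdeal := by
        intro (h0 : φ₀ (ι (X (0,1)) - 1) = 0)
        rw [map_sub, map_one, hφ₀, hψ₀X, hv01] at h0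
        have h1 : algebraMap (MvPolynomial (Fin 2) (ZMod p))
            (Localization.Away (X 0 * X 1 : MvPolynomial (Fin 2) (ZMod p))) (X 0 - 1) =
            algebraMap (MvPolynomial (Fin 2) (ZMod p)) _ 0 := by
          rw [map_sub, map_one, map_zero]; exact h0
        exact hX0 (hinj₀ h1)
      rw [h] at hnot
      exact hnot hmem
  have h12 : q₁ < q₂ := by
    refine lt_of_le_of_ne ?_ ?_
    · intro t (ht : φ₁ t = 0)
      show ρ₂ (φ₁ t) = 0
      rw [ht, map_zero]
    · intro h
      have hmem : ι (X (2,0)) - 1 ∈ q₂.asIdeal := by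
        show ρ₂ (ρ₁ (φ₀ (ι (X (2,0)) - 1))) = 0
        rw [map_sub, map_one, hφ₀, hψ₀X, hv20, map_sub, map_one, hρ₁, he₁1, map_sub, map_one,
          hρ₂, he₂1, sub_self]
      have hnot : ι (X (2,0)) - 1 ∉ q₁.asIdeal := by
        intro (h0 : ρ₁ (φ₀ (ι (X (2,0)) - 1)) = 0)
        rw [map_sub, map_one, hφ₀, hψ₀X, hv20, map_sub, map_one, hρ₁, he₁1] at h0
        have h1 : algebraMap (MvPolynomial (Fin 2) (ZMod p))
            (Localization.Away (X 1 : MvPolynomial (Fin 2) (ZMod p))) (X 1 - 1) =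
            algebraMap (MvPolynomial (Fin 2) (ZMod p)) _ 0 := by
          rw [map_sub, map_one, map_zero]; exact h0
        exact hX1 (hinj₁ h1)
      rw [h] at hnot
      exact hnot hmem
  let σ : LTSeries (PrimeSpectrum T) :=
    ⟨2, ![q₀, q₁, q₂], fun i => by
      fin_cases i
      · simpa using h01
      · simpa using h12⟩
  exact Order.LTSeries.length_le_krullDim σ

end Chart

end Summit.ResolutionOfSingularities.ResolutionOfSingularities.Theorems.MatroidCellRes.Negative

end
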